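import Summits.QuantumFields.BalabanUV.Beta.NVertexLamCorePeriodised

/-!
# `BalabanUV.Beta.NVertexLamWeightLadder` — row D1 ∕ (C1), PART 18: **THE TRANSPORTED MULTIPLIER RESPONSE DESCENDS THE STOREYS BY ONE BRICK AT A TIME —
# `λ′ᴿ_{k−1} (κ,s) = Σ_{κ₁} Σ'_{s₁} λ′ᴿ_k (κ₁,s₁) · ℓ κ₁ s₁ (κ,s)`, from the TOP value `λ′ᴿ_j = Λ′_N` (PART 16 `lamR_top`); and the PERIODISED weights obey the
# same one-brick ladder over the slot tori `Ma` (`Ma (k−1) = Lc · Ma k`)** — the row-side twin of the END wrapper's `hlink` ladder (`TowerHSideRowsClosing.a1_row`'s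
# binders: level-`k` weight × one (0.4)-sym linear brick = level-`(k+1)` weight), so that SPEC-49 §B's weight word is ONE identity at the top storey ((K1) for the
# nested column) plus scalar bookkeeping per step

WHY (located).  PARTs 15–17 put the right side of road FP's (E4b) `hΛN` in closed form: per storey a `compLinKer`-sandwich around the PERIODISED core
`−cΛ · Σ_κ Σ_{r ∈ pbox (Ma j')} (Σ'_m λ′ᴿ_k (κ, r + (Ma j')∘m)) · dper Tc (𝒽 κ r)♭`, and READ (J-Λ-lat) as the per-storey junction
`w j' · Σ_ā hb j' ā · (Σ'_m cf j' κ (translate (Ma j') r m) ā.2 ā.1) = cΛ · Σ'_m λ′ᴿ_k (κ, translate (Ma j') r m)` (× leg scalars).  The wrapper does not bind its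
storey weights `hb k` one by one: it DISPLAYS the top one through (K1) and the others through the ladder `hlink` (level-`k` weight contracted with ONE brick
`symLinKerAt (ctr) Lc μ y (a)` = level-`(k+1)` weight at `a`, up to `w ∕ κ ∕ stepScale` scalars).  THIS FILE shows the ROW's weights have exactly that structure:
§1 (generic) an2 g60's composite linear kernel peels at the BOTTOM as well as at the top — **`compLinKer_succ_bottom : compLinKer ℓ L (m+1) f g =
Σ_{κ₁} Σ'_{s₁} compLinKer (ℓ∘succ) L m (κ₁,s₁) g · ℓ 0 κ₁ s₁ f`** (induction over `compLinKer_succ`; the base case is the window letter `sum_window_mul_indicator`,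
so the bottom brick must be window-supported); §2 (record, constant brick list `ℓ _ := symLinKerAt (toSite R.r) Lc`) **`lamR_succ : λ′ᴿ at depth m+1 =
Σ_{κ₁} Σ'_{s₁} (λ′ᴿ at depth m) (κ₁,s₁) · symLinKerAt (toSite R.r) Lc κ₁ s₁ (κ,s)`** (one storey down = one brick; the `w`-sum exchanged with the finitely
supported `s₁`-sum); §3 the PERIODISED ladder **`periodised_lamR_succ`**: with `T″ i = Lc · T′ i` (the slot torus one storey down is the storey torus above),
`Σ'_n λ′ᴿ_{m+1} (κ, translate T″ s n) = Σ_{κ₁} Σ'_{s₁} (Σ'_n λ′ᴿ_m (κ₁, translate T′ s₁ n)) · symLinKerAt (toSite R.r) Lc κ₁ s₁ (κ,s)` (brick covariance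
`symLinKerAt_add`, re-indexing, the `n`-sum exchanged with the finitely supported `s₁`-sum) — the shape of `hlink` read on the row's weights, and at the
wrapper's tower `periodised_lamR_succ_tower` (`T′ := towerTorus Lc M m'`, `T″ := towerTorus Lc (fine Lc M) m'`).
READING: (J-Λ-lat) ⟸ the TOP junction `w n 0 · Σ_ā hb n B 0 v ā · (Σ'_m cf n B 0 κ (translate (Ma 0) r m) ā.2 ā.1) = cΛ (n+2) · Σ'_m Λ′_N (κ, translate (Ma 0) r m)`
((K1) for the nested column, periodised — the road's) + agreement of the two ladders' scalars step by step (`hlink`'s `w (k+1) κ (k+1) ∕ (stepScale · Lc^{d+1})`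
against PART 17's leg scalars) — bookkeeping the road owns; nothing else of the row is needed.

WHAT ([folklore] finite-sum ∕ `tsum` bookkeeping BY NAME; no `def`, no `def … : Prop`, nothing cited, 0 sorry): §1 `compLinKer_succ_bottom`, `summable_compLinKer_bottom`;
§2 `lamR_succ`; §3 `periodised_lamR_succ`, `periodised_lamR_succ_tower`.
WHAT THIS IS NOT: not (J-Λ-lat) itself (the top junction and the scalar bookkeeping are the road's instantiation); not (K1) for the nested column; not
(J-W″)∕(J-X)∕(J-Λ-X); no row of the END wrapper discharged; 0 estimates; nothing of Bałaban's asserted, valued or discharged; 0∕4 row-D1 binders (hW, hR, D1Tel,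
D1Rep); ROOT M‴ p325680 ∕ P5c ∕ D6 untouched; NOT (C1), NOT (L2′), NOT D1, NEVER «G-an2-4 closed», NOT BetaPertH, NOT continuum, NOT Clay.

HONEST DEPENDENCY (page 1, mandatory): continuum YM on T⁴ ⇐ BetaPertH ∧ nine spine estimates (0/9 proved); BetaPertH ⇐ (D1) ∧ (D4) ∧ CAP+tail;
G-an2-4 gates asym, D1 and NE2/3/4.  HONEST FRAMING (cell contract, verbatim): «discharging `BetaPertH` makes Bałaban's UV stability UNCONDITIONAL —
a real constructive-QFT result; it is NOT the continuum limit and NOT the Clay problem.»  ABSOLUTE RULE (cell charter, verbatim): «No internally-minted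
statement may enter as a cited fact. Every hypothesis is either kernel-proved in this package or a verbatim quotation of a PUBLISHED theorem with page
reference. The manuscript(s) under audit are NOT citable for their own disputed steps — they are the thing under adjudication; programme-internal
(2001/route/tribunal) claims are never citable.»  Row D1 ∕ (C1) OWNER an2 (b2b-balaban-beta-an2) gen 62, 2026-08-27.  No existing file touched.
-/

noncomputable section

open scoped BigOperators

namespace Summit.QuantumFields.BalabanUV.Beta.NVertexLamWeightLadder

open Finset
open Literature.MathematicalPhysics.QuantumFieldTheory
open Literature.MathematicalPhysics.QuantumFieldTheory.Balaban1983to89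
open Literature.MathematicalPhysics.QuantumFieldTheory.Balaban1983to89.Beta
open B4TorusKernel.MultiPeriod (translate translate_injective)
open B5Prop11Plancherel (fine)
open AffineAveraging (Site box toSite)
open AveragingHessianKernels (Bond Near ell)
open OneStepResolventKernel (Fib KInv)
open BalabanStepJets (lamCoeffOf)
open Summit.QuantumFields.BalabanUV.Beta.AxialDressingRooted (one_le_of_neZero)
open Summit.QuantumFields.BalabanUV.Beta.SymAveragingHessianCounts (symLinKerAt symLinKerAt_eq_zero symLinKerAt_add abs_symLinKerAt_le)
open Summit.QuantumFields.BalabanUV.Beta.CompositeVertexKernelRec (offs compLinKer winF wid compLinKer_zero compLinKer_succ compLinKer_eq_zero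
  sum_window_mul_indicator abs_compLinKer_le)
open Summit.QuantumFields.BalabanUV.Beta.CompositeOneShotJetData (Roots AN)
open Summit.QuantumFields.BalabanUV.Beta.FP.KernelPeriodisationFib (translate_eq_add)
open Summit.QuantumFields.BalabanUV.Beta.FP.TorusCompositeObjects (towerTorus)
open Summit.QuantumFields.BalabanUV.Beta.NVertexLamSectorContracted (summable_LamN)
open Summit.QuantumFields.BalabanUV.Beta.NVertexLamSectorStoreyKernels (summable_pullback_LamN)
open Summit.QuantumFields.BalabanUV.Beta.NVertexLamCorePeriodised (slot_mem_nearBox_of_near towerTorus_fine_apply_eq)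

variable {d : ℕ}

/-! ## §1 Generic: the composite linear kernel peels at the bottom -/

section Bottom

variable {ℓ : ℕ → Fin (d + 1) → Site (d + 1) → Bond (d + 1) → ℝ} {L : ℕ}

/-- [folklore] for a fixed top bond the bottom-peeled family is finitely supported in the level-one site (an2 g60's `compLinKer_eq_zero` for the shifted brick list):
`s₁ ↦ compLinKer (ℓ∘succ) L m (κ₁,s₁) g · c s₁` is summable for every `c`. -/
theorem summable_compLinKer_bottom (m : ℕ) (κ₁ : Fin (d + 1)) (g : Bond (d + 1)) (c : Site (d + 1) → ℝ) :
    Summable fun s₁ : Site (d + 1) => compLinKer (fun i => ℓ (i + 1)) L m (κ₁, s₁) g * c s₁ :=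
  summable_of_ne_finset_zero (s := winF (L ^ m) (wid L m) g.2) fun s₁ hs₁ => by
    rw [compLinKer_eq_zero (ℓ := fun i => ℓ (i + 1)) m (f := (κ₁, s₁)) (g := g) hs₁, zero_mul]

/-- [folklore] **`compLinKer_succ_bottom` — THE COMPOSITE LINEAR KERNEL PEELS AT THE BOTTOM**: for a window-supported bottom brick,
`compLinKer ℓ L (m+1) f g = Σ_{κ₁} Σ'_{s₁} compLinKer (ℓ∘succ) L m (κ₁,s₁) g · ℓ 0 κ₁ s₁ f` — the coefficient of the finest bond `f` in the `(m+1)`-fold composite at the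
top bond `g` is the sum over the level-one bonds `(κ₁,s₁)` of (their coefficient in the `m`-fold composite of the upper bricks at `g`) × (the bottom brick at `(κ₁,s₁)`
reading `f`).  Induction on `m` over an2 g60's top-peel `compLinKer_succ`; base case = `sum_window_mul_indicator`. -/
theorem compLinKer_succ_bottom (hℓ0 : ∀ (μ : Fin (d + 1)) (y : Site (d + 1)) (f : Bond (d + 1)), ¬ Near L y f.2 → ℓ 0 μ y f = 0) :
    ∀ (m : ℕ) (f g : Bond (d + 1)), compLinKer ℓ L (m + 1) f g
      = ∑ κ₁ : Fin (d + 1), ∑' s₁ : Site (d + 1), compLinKer (fun i => ℓ (i + 1)) L m (κ₁, s₁) g * ℓ 0 κ₁ s₁ f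
  | 0, f, g => by
      obtain ⟨g₁, g₂⟩ := g
      rw [compLinKer_succ]
      simp only [compLinKer_zero]
      rw [sum_window_mul_indicator (L := L) (fun f' => ℓ 0 g₁ g₂ f') g₂ f (hℓ0 g₁ g₂ f)]
      rw [Finset.sum_eq_single_of_mem g₁ (Finset.mem_univ g₁) (fun κ₁ _ hκ₁ => ?_)]
      · rw [tsum_eq_single g₂ (fun s₁ hs₁ => ?_)]
        · rw [if_pos rfl, one_mul]
        · rw [if_neg (fun h => hs₁ (Prod.mk.inj h).2.symm), zero_mul]
      · exact (tsum_congr fun s₁ => by rw [if_neg (fun h => hκ₁ (Prod.mk.inj h).1.symm), zero_mul]).trans tsum_zero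
  | m + 1, f, g => by
      rw [compLinKer_succ]
      simp_rw [compLinKer_succ_bottom hℓ0 m f]
      -- push the top brick inside and exchange the finite window sums with the finitely supported `s₁`-sum
      have hX : ∀ (κ : Fin (d + 1)) (e : Site (d + 1)),
          ℓ (m + 1) g.1 g.2 (κ, (L : ℤ) • g.2 + e)
              * ∑ κ₁ : Fin (d + 1), ∑' s₁ : Site (d + 1), compLinKer (fun i => ℓ (i + 1)) L m (κ₁, s₁) (κ, (L : ℤ) • g.2 + e) * ℓ 0 κ₁ s₁ f
            = ∑ κ₁ : Fin (d + 1), ∑' s₁ : Site (d + 1),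
                ℓ (m + 1) g.1 g.2 (κ, (L : ℤ) • g.2 + e) * (compLinKer (fun i => ℓ (i + 1)) L m (κ₁, s₁) (κ, (L : ℤ) • g.2 + e) * ℓ 0 κ₁ s₁ f) :=
        fun κ e => by
          rw [Finset.mul_sum]
          exact Finset.sum_congr rfl fun κ₁ _ => tsum_mul_left.symm
      simp_rw [hX]
      have hS : ∀ (κ : Fin (d + 1)) (e : Site (d + 1)) (κ₁ : Fin (d + 1)), Summable fun s₁ : Site (d + 1) =>
          ℓ (m + 1) g.1 g.2 (κ, (L : ℤ) • g.2 + e) * (compLinKer (fun i => ℓ (i + 1)) L m (κ₁, s₁) (κ, (L : ℤ) • g.2 + e) * ℓ 0 κ₁ s₁ f) :=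
        fun κ e κ₁ => (summable_compLinKer_bottom (ℓ := ℓ) (L := L) m κ₁ (κ, (L : ℤ) • g.2 + e) (fun s₁ => ℓ 0 κ₁ s₁ f)).mul_left _
      -- (κ, e, κ₁, s₁) ↦ (κ₁, s₁, κ, e)
      calc ∑ κ : Fin (d + 1), ∑ e ∈ offs L, ∑ κ₁ : Fin (d + 1), ∑' s₁ : Site (d + 1),
              ℓ (m + 1) g.1 g.2 (κ, (L : ℤ) • g.2 + e) * (compLinKer (fun i => ℓ (i + 1)) L m (κ₁, s₁) (κ, (L : ℤ) • g.2 + e) * ℓ 0 κ₁ s₁ f)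
          = ∑ κ₁ : Fin (d + 1), ∑ κ : Fin (d + 1), ∑ e ∈ offs L, ∑' s₁ : Site (d + 1),
              ℓ (m + 1) g.1 g.2 (κ, (L : ℤ) • g.2 + e) * (compLinKer (fun i => ℓ (i + 1)) L m (κ₁, s₁) (κ, (L : ℤ) • g.2 + e) * ℓ 0 κ₁ s₁ f) := by
            symm
            rw [Finset.sum_comm]
            exact Finset.sum_congr rfl fun κ _ => Finset.sum_comm
        _ = ∑ κ₁ : Fin (d + 1), ∑' s₁ : Site (d + 1), ∑ κ : Fin (d + 1), ∑ e ∈ offs L,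
              ℓ (m + 1) g.1 g.2 (κ, (L : ℤ) • g.2 + e) * (compLinKer (fun i => ℓ (i + 1)) L m (κ₁, s₁) (κ, (L : ℤ) • g.2 + e) * ℓ 0 κ₁ s₁ f) := by
            refine Finset.sum_congr rfl fun κ₁ _ => ?_
            rw [Summable.tsum_finsetSum fun κ _ => summable_sum fun e _ => hS κ e κ₁]
            exact Finset.sum_congr rfl fun κ _ => (Summable.tsum_finsetSum fun e _ => hS κ e κ₁).symm
        _ = ∑ κ₁ : Fin (d + 1), ∑' s₁ : Site (d + 1), compLinKer (fun i => ℓ (i + 1)) L (m + 1) (κ₁, s₁) g * ℓ 0 κ₁ s₁ f := by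
            refine Finset.sum_congr rfl fun κ₁ _ => tsum_congr fun s₁ => ?_
            rw [compLinKer_succ, Finset.sum_mul]
            refine Finset.sum_congr rfl fun κ _ => ?_
            rw [Finset.sum_mul]
            exact Finset.sum_congr rfl fun e _ => by ring

end Bottom

/-! ## §2 At the record: one storey down = one brick -/

section Record

variable {Lc : ℕ} [NeZero Lc] (R : Roots Lc) (j : ℕ)

/-- [folklore] **`lamR_succ` — THE TRANSPORTED MULTIPLIER RESPONSE ONE STOREY DOWN IS THE ONE ABOVE CONTRACTED WITH ONE BRICK**: at the record's constant brick list
`ℓ _ := symLinKerAt (toSite R.r) Lc` (window-supported: `symLinKerAt_eq_zero R.hr`), for every depth `m` and slot `(κ, s)`,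
`Σ_ν Σ'_w Λ′_N (ν,w) · compLinKer ℓ Lc (m+1) (κ,s) (ν,w) = Σ_{κ₁} Σ'_{s₁} (Σ_ν Σ'_w Λ′_N (ν,w) · compLinKer ℓ Lc m (κ₁,s₁) (ν,w)) · symLinKerAt (toSite R.r) Lc κ₁ s₁ (κ,s)`
(`compLinKer_succ_bottom`; the `s₁`-sum is finitely supported in the near-box of `s`, the `w`-sums are finitely supported by F6a″ `summable_mul_compLinKer_top`). -/
theorem lamR_succ (m : ℕ) (μ κ : Fin (3 + 1)) (y s : Site (3 + 1)) :
    (∑ ν : Fin (3 + 1), ∑' w : Site (3 + 1),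
        (∑ κ' : Fin (3 + 1), ∑' u : Site (3 + 1),
            AN R j u (((Lc ^ (j + 1) : ℕ) : ℤ) • y) (Sum.inl κ') (Sum.inr μ) * lamCoeffOf (KInv (N := Lc ^ (j + 1)) (d := 3)) (Lc ^ (j + 1)) ν w κ' u)
          * compLinKer (fun _ => symLinKerAt (toSite R.r) Lc) Lc (m + 1) (κ, s) (ν, w))
      = ∑ κ₁ : Fin (3 + 1), ∑' s₁ : Site (3 + 1),
          (∑ ν : Fin (3 + 1), ∑' w : Site (3 + 1),
              (∑ κ' : Fin (3 + 1), ∑' u : Site (3 + 1),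
                  AN R j u (((Lc ^ (j + 1) : ℕ) : ℤ) • y) (Sum.inl κ') (Sum.inr μ) * lamCoeffOf (KInv (N := Lc ^ (j + 1)) (d := 3)) (Lc ^ (j + 1)) ν w κ' u)
                * compLinKer (fun _ => symLinKerAt (toSite R.r) Lc) Lc m (κ₁, s₁) (ν, w))
            * symLinKerAt (toSite R.r) Lc κ₁ s₁ (κ, s) := by
  have hL : 0 < Lc := Nat.pos_of_ne_zero (NeZero.ne Lc)
  set NB := Fintype.piFinset (fun i => Finset.Icc ((s i - ((2 * Lc - 1 : ℕ) : ℤ)) / (Lc : ℤ)) (s i / (Lc : ℤ))) with hNB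
  have h0 : ∀ (κ₁ : Fin (3 + 1)) (s₁ : Site (3 + 1)), s₁ ∉ NB → symLinKerAt (toSite R.r) Lc κ₁ s₁ (κ, s) = 0 :=
    fun κ₁ s₁ hs₁ => symLinKerAt_eq_zero R.hr (f := (κ, s)) fun h => hs₁ (slot_mem_nearBox_of_near hL h)
  -- bottom peel at the constant brick list (its shifted list is itself)
  have hpeel : ∀ (ν : Fin (3 + 1)) (w : Site (3 + 1)),
      compLinKer (fun _ => symLinKerAt (toSite R.r) Lc) Lc (m + 1) (κ, s) (ν, w)
        = ∑ κ₁ : Fin (3 + 1), ∑ s₁ ∈ NB, compLinKer (fun _ => symLinKerAt (toSite R.r) Lc) Lc m (κ₁, s₁) (ν, w) * symLinKerAt (toSite R.r) Lc κ₁ s₁ (κ, s) :=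
    fun ν w => by
      rw [compLinKer_succ_bottom (ℓ := fun _ => symLinKerAt (toSite R.r) Lc) (L := Lc) (fun μ' y' f h => symLinKerAt_eq_zero R.hr h) m (κ, s) (ν, w)]
      exact Finset.sum_congr rfl fun κ₁ _ => tsum_eq_sum fun s₁ hs₁ => by rw [h0 κ₁ s₁ hs₁, mul_zero]
  -- the `w`-sums are finitely supported for each fixed lower slot
  have hw : ∀ (ν κ₁ : Fin (3 + 1)) (s₁ : Site (3 + 1)), Summable fun w : Site (3 + 1) =>
      (∑ κ' : Fin (3 + 1), ∑' u : Site (3 + 1),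
          AN R j u (((Lc ^ (j + 1) : ℕ) : ℤ) • y) (Sum.inl κ') (Sum.inr μ) * lamCoeffOf (KInv (N := Lc ^ (j + 1)) (d := 3)) (Lc ^ (j + 1)) ν w κ' u)
        * (compLinKer (fun _ => symLinKerAt (toSite R.r) Lc) Lc m (κ₁, s₁) (ν, w) * symLinKerAt (toSite R.r) Lc κ₁ s₁ (κ, s)) := fun ν κ₁ s₁ =>
    ((CompositeVertexKernelLiftKernel.summable_mul_compLinKer_top (ℓ := fun _ => symLinKerAt (toSite R.r) Lc) hL 0 m
      (fun w' => ∑ κ' : Fin (3 + 1), ∑' u : Site (3 + 1),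
          AN R j u (((Lc ^ (j + 1) : ℕ) : ℤ) • y) (Sum.inl κ') (Sum.inr μ) * lamCoeffOf (KInv (N := Lc ^ (j + 1)) (d := 3)) (Lc ^ (j + 1)) ν w' κ' u)
      κ₁ ν s₁).mul_right (symLinKerAt (toSite R.r) Lc κ₁ s₁ (κ, s))).congr fun w => by ring
  simp_rw [hpeel, Finset.mul_sum]
  -- the finite sums `κ₁`, `s₁ ∈ NB` come out of the `w`-sum, then in front of `ν`
  rw [Finset.sum_congr rfl fun ν _ =>
      Summable.tsum_finsetSum (s := (Finset.univ : Finset (Fin (3 + 1)))) fun κ₁ _ => summable_sum (s := NB) fun s₁ _ => hw ν κ₁ s₁]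
  rw [Finset.sum_congr rfl fun ν _ => Finset.sum_congr rfl fun κ₁ _ => Summable.tsum_finsetSum (s := NB) fun s₁ _ => hw ν κ₁ s₁]
  rw [Finset.sum_comm]
  refine Finset.sum_congr rfl fun κ₁ _ => ?_
  rw [Finset.sum_comm, tsum_eq_sum (s := NB) fun s₁ hs₁ => by rw [h0 κ₁ s₁ hs₁, mul_zero]]
  refine Finset.sum_congr rfl fun s₁ _ => ?_
  rw [Finset.sum_mul]
  refine Finset.sum_congr rfl fun ν _ => ?_
  rw [← tsum_mul_right]
  exact tsum_congr fun w => by ring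

end Record

/-! ## §3 The periodised weights obey the same one-brick ladder -/

section Periodised

variable {Lc : ℕ} [NeZero Lc] (R : Roots Lc) (j : ℕ) (T' T'' : Fin (3 + 1) → ℕ)

omit [NeZero Lc] in
/-- [folklore] **the brick moves a translate of the lower slot onto a translate of the upper slot**: with `T″ i = Lc · T′ i`,
`Σ'_{s₁} F s₁ · ℓ κ₁ s₁ (κ, translate T″ s n) = Σ'_{s₁} F (translate T′ s₁ n) · ℓ κ₁ s₁ (κ, s)` for any `F` (re-index `s₁ ↦ s₁ + T′∘n`, `symLinKerAt_add`). -/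
theorem tsum_mul_brick_translate (hT : ∀ i, T'' i = Lc * T' i) (F : Site (3 + 1) → ℝ) (κ₁ κ : Fin (3 + 1)) (s n : Site (3 + 1)) :
    (∑' s₁ : Site (3 + 1), F s₁ * symLinKerAt (toSite R.r) Lc κ₁ s₁ (κ, translate T'' s n))
      = ∑' s₁ : Site (3 + 1), F (translate T' s₁ n) * symLinKerAt (toSite R.r) Lc κ₁ s₁ (κ, s) := by
  set t : Site (3 + 1) := fun i => (T' i : ℤ) * n i with ht
  rw [← (Equiv.addRight t).tsum_eq fun s₁ => F s₁ * symLinKerAt (toSite R.r) Lc κ₁ s₁ (κ, translate T'' s n)]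
  refine tsum_congr fun s₁ => ?_
  rw [Equiv.coe_addRight, NVertexLamCorePeriodised.bond_translate_eq_sh T'' T' hT κ s n, ← ht, symLinKerAt_add (toSite R.r) Lc κ₁ s₁ t (κ, s),
    translate_eq_add T' s₁ n]

/-- [folklore] **`periodised_lamR_succ` — THE PERIODISED WEIGHTS OBEY THE SAME LADDER** (the shape of the wrapper's `hlink`, read on the row's weights): with
`T″ i = Lc · T′ i` (the slot torus one storey down IS the storey torus above; `1 ≤ T′ i`),
`Σ'_n λ′ᴿ_{m+1} (κ, translate T″ s n) = Σ_{κ₁} Σ'_{s₁} (Σ'_n λ′ᴿ_m (κ₁, translate T′ s₁ n)) · symLinKerAt (toSite R.r) Lc κ₁ s₁ (κ,s)`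
(`lamR_succ` at the translated slot, `tsum_mul_brick_translate`, the `n`-sum exchanged with the finitely supported `s₁`-sum; `n`-summability by PART 15's
`summable_lamR` and injectivity of `translate T′ s₁`). -/
theorem periodised_lamR_succ (hT : ∀ i, T'' i = Lc * T' i) (hT' : ∀ i, 1 ≤ T' i) (m : ℕ) (μ κ : Fin (3 + 1)) (y s : Site (3 + 1)) :
    (∑' n : Site (3 + 1), ∑ ν : Fin (3 + 1), ∑' w : Site (3 + 1),
        (∑ κ' : Fin (3 + 1), ∑' u : Site (3 + 1),
            AN R j u (((Lc ^ (j + 1) : ℕ) : ℤ) • y) (Sum.inl κ') (Sum.inr μ) * lamCoeffOf (KInv (N := Lc ^ (j + 1)) (d := 3)) (Lc ^ (j + 1)) ν w κ' u)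
          * compLinKer (fun _ => symLinKerAt (toSite R.r) Lc) Lc (m + 1) (κ, translate T'' s n) (ν, w))
      = ∑ κ₁ : Fin (3 + 1), ∑' s₁ : Site (3 + 1),
          (∑' n : Site (3 + 1), ∑ ν : Fin (3 + 1), ∑' w : Site (3 + 1),
              (∑ κ' : Fin (3 + 1), ∑' u : Site (3 + 1),
                  AN R j u (((Lc ^ (j + 1) : ℕ) : ℤ) • y) (Sum.inl κ') (Sum.inr μ) * lamCoeffOf (KInv (N := Lc ^ (j + 1)) (d := 3)) (Lc ^ (j + 1)) ν w κ' u)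
                * compLinKer (fun _ => symLinKerAt (toSite R.r) Lc) Lc m (κ₁, translate T' s₁ n) (ν, w))
            * symLinKerAt (toSite R.r) Lc κ₁ s₁ (κ, s) := by
  have hL : 0 < Lc := Nat.pos_of_ne_zero (NeZero.ne Lc)
  set NB := Fintype.piFinset (fun i => Finset.Icc ((s i - ((2 * Lc - 1 : ℕ) : ℤ)) / (Lc : ℤ)) (s i / (Lc : ℤ))) with hNB
  have h0 : ∀ (κ₁ : Fin (3 + 1)) (s₁ : Site (3 + 1)), s₁ ∉ NB → symLinKerAt (toSite R.r) Lc κ₁ s₁ (κ, s) = 0 :=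
    fun κ₁ s₁ hs₁ => symLinKerAt_eq_zero R.hr (f := (κ, s)) fun h => hs₁ (slot_mem_nearBox_of_near hL h)
  -- the weight at depth `m` is summable in its slot, hence translate-summable in `n`
  have hn : ∀ (κ₁ : Fin (3 + 1)) (s₁ : Site (3 + 1)), Summable fun n : Site (3 + 1) =>
      ∑ ν : Fin (3 + 1), ∑' w : Site (3 + 1),
        (∑ κ' : Fin (3 + 1), ∑' u : Site (3 + 1),
            AN R j u (((Lc ^ (j + 1) : ℕ) : ℤ) • y) (Sum.inl κ') (Sum.inr μ) * lamCoeffOf (KInv (N := Lc ^ (j + 1)) (d := 3)) (Lc ^ (j + 1)) ν w κ' u)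
          * compLinKer (fun _ => symLinKerAt (toSite R.r) Lc) Lc m (κ₁, translate T' s₁ n) (ν, w) :=
    fun κ₁ s₁ => (NVertexLamSectorStoreyKernels.summable_lamR R j μ κ₁ y m).comp_injective (translate_injective hT' s₁)
  -- each translate of the lower slot: the ladder, then the brick moves the translate upstairs, then cut to the near-box
  have hpt : ∀ n : Site (3 + 1),
      (∑ ν : Fin (3 + 1), ∑' w : Site (3 + 1),
          (∑ κ' : Fin (3 + 1), ∑' u : Site (3 + 1),
              AN R j u (((Lc ^ (j + 1) : ℕ) : ℤ) • y) (Sum.inl κ') (Sum.inr μ) * lamCoeffOf (KInv (N := Lc ^ (j + 1)) (d := 3)) (Lc ^ (j + 1)) ν w κ' u)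
            * compLinKer (fun _ => symLinKerAt (toSite R.r) Lc) Lc (m + 1) (κ, translate T'' s n) (ν, w))
        = ∑ κ₁ : Fin (3 + 1), ∑ s₁ ∈ NB,
            (∑ ν : Fin (3 + 1), ∑' w : Site (3 + 1),
                (∑ κ' : Fin (3 + 1), ∑' u : Site (3 + 1),
                    AN R j u (((Lc ^ (j + 1) : ℕ) : ℤ) • y) (Sum.inl κ') (Sum.inr μ) * lamCoeffOf (KInv (N := Lc ^ (j + 1)) (d := 3)) (Lc ^ (j + 1)) ν w κ' u)
                  * compLinKer (fun _ => symLinKerAt (toSite R.r) Lc) Lc m (κ₁, translate T' s₁ n) (ν, w))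
              * symLinKerAt (toSite R.r) Lc κ₁ s₁ (κ, s) := fun n => by
    rw [lamR_succ R j m μ κ y (translate T'' s n)]
    refine Finset.sum_congr rfl fun κ₁ _ => ?_
    rw [tsum_mul_brick_translate R T' T'' hT _ κ₁ κ s n]
    exact tsum_eq_sum fun s₁ hs₁ => by rw [h0 κ₁ s₁ hs₁, mul_zero]
  simp_rw [hpt]
  rw [Summable.tsum_finsetSum fun κ₁ _ => summable_sum fun s₁ _ => (hn κ₁ s₁).mul_right _]
  refine Finset.sum_congr rfl fun κ₁ _ => ?_
  rw [Summable.tsum_finsetSum fun s₁ _ => (hn κ₁ s₁).mul_right _,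
    tsum_eq_sum (s := NB) fun s₁ hs₁ => by rw [h0 κ₁ s₁ hs₁, mul_zero]]
  exact Finset.sum_congr rfl fun s₁ _ => tsum_mul_right

/-- [folklore] **`periodised_lamR_succ_tower` — AT THE WRAPPER's TOWER**: the slot torus one storey down is `towerTorus Lc (fine Lc M) m'` over `towerTorus Lc M m'`
(`towerTorus_fine_apply_eq` = the wrapper's `hMa`). -/
theorem periodised_lamR_succ_tower (M : Fin (3 + 1) → ℕ) [∀ i, NeZero (M i)] (m' m : ℕ) (μ κ : Fin (3 + 1)) (y s : Site (3 + 1)) :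
    (∑' n : Site (3 + 1), ∑ ν : Fin (3 + 1), ∑' w : Site (3 + 1),
        (∑ κ' : Fin (3 + 1), ∑' u : Site (3 + 1),
            AN R j u (((Lc ^ (j + 1) : ℕ) : ℤ) • y) (Sum.inl κ') (Sum.inr μ) * lamCoeffOf (KInv (N := Lc ^ (j + 1)) (d := 3)) (Lc ^ (j + 1)) ν w κ' u)
          * compLinKer (fun _ => symLinKerAt (toSite R.r) Lc) Lc (m + 1) (κ, translate (towerTorus Lc (fine Lc M) m') s n) (ν, w))
      = ∑ κ₁ : Fin (3 + 1), ∑' s₁ : Site (3 + 1),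
          (∑' n : Site (3 + 1), ∑ ν : Fin (3 + 1), ∑' w : Site (3 + 1),
              (∑ κ' : Fin (3 + 1), ∑' u : Site (3 + 1),
                  AN R j u (((Lc ^ (j + 1) : ℕ) : ℤ) • y) (Sum.inl κ') (Sum.inr μ) * lamCoeffOf (KInv (N := Lc ^ (j + 1)) (d := 3)) (Lc ^ (j + 1)) ν w κ' u)
                * compLinKer (fun _ => symLinKerAt (toSite R.r) Lc) Lc m (κ₁, translate (towerTorus Lc M m') s₁ n) (ν, w))
            * symLinKerAt (toSite R.r) Lc κ₁ s₁ (κ, s) :=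
  periodised_lamR_succ R j (towerTorus Lc M m') (towerTorus Lc (fine Lc M) m') (towerTorus_fine_apply_eq M m')
    (fun i => one_le_of_neZero (towerTorus Lc M m' i)) m μ κ y s

end Periodised

end Summit.QuantumFields.BalabanUV.Beta.NVertexLamWeightLadder

end
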